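import Summits.RiemannHypothesis.RiemannHypothesis.Theorems.SemilocalPolyWitness
import Summits.RiemannHypothesis.RiemannHypothesis.Theorems.SemilocalArchMajorant
import HarnessLib

/-!
# Semi-local threshold, negative side — the polar moment `Ĝ(1)` and the value `D(log 2)` as rationals

Cell `rh-explicit` (HOME `run/shared/lean/pub/rh-explicit/`), seat cc-s2-4 (`HOME/cc-s2-4/CC4-THRESHOLD-PLAN.md` §2).
Honest framing: bookkeeping for NEGATIVE certificates about the tree's `weilSemilocalThreshold {2}`; nothing here
bears on RH.

For the polynomial Markov witness `G = p·1_{[−b,b]}` (`SemilocalPolyWitness.lean`) the criterion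
`IsMarkovWitness.not_weilSemilocalPositivityOn_two_polar` needs, besides `∫ w·D` (files `SemilocalArchMajorant`,
`SemilocalArchTail`), two more numbers:

* the POLAR MOMENT `Ĝ(1) = ∫_{−b}^{b} p(x) e^{x/2} dx` — `weilMellin_polyWitness_one` identifies it with a real
  integral, `abs_mellinOne_sub_partial_le` encloses it: `|Ĝ(1) − I_n| ≤ ε_n` with the RATIONALS
  `I_n = ∫_{−b}^{b} p · T_n(x/2)` (`mellinOnePartialQ`, `T_n` the Maclaurin polynomial of `exp`, exact list integral) and
  `ε_n = 2b · M · (b/2)^n (n+1)/(n!·n)` (`mellinOneErrQ`, `M = absBound p b`; `Real.exp_bound`, `b ≤ 2`), whence the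
  lower bound `mellinOneLowerQ ≤ ‖Ĝ(1)‖` (`mellinOneLowerQ_le_norm`);
* the VALUE `D(L)` at an irrational point `L ∈ [L₀, L₀ + δ]` (here `L = log 2`, `L₀`, `δ` from the tree's 20-digit
  bounds) — `ev_le_evalUpperQ`: `ev l L ≤ a₀ + δ · absBound (tail) δ`, where `a₀ :: tail = collapse (shiftB l) L₀`
  are the RATIONAL Taylor coefficients of `l` at `L₀` (`ev_collapse_shiftB`: `ev l (L₀ + y) = ev (collapse (shiftB l) L₀) y`).

Generic replacements of lad-2's per-witness `MotivicDoorSemilocalUndecicPolar.lean` (hand-expanded `pTU` table) and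
`…UndecicKernelB.lean` (`D(log 2)` by cells).  Folklore throughout.
-/

set_option linter.dupNamespace false  -- the mandated namespace repeats `RiemannHypothesis`

noncomputable section

open MeasureTheory Set Finset Real
open Literature.NumberTheory.LFunctions
open scoped Interval

namespace Summit.RiemannHypothesis.RiemannHypothesis.Theorems.SemilocalPolyWitness

open LQ

/-! ## Evaluating a list at an enclosed irrational point -/

/-- Collapse a bivariate list at a rational `x = c`: the `t`-coefficient list of `Q(c, t)` (Horner in `x`). -/
def collapse : List (List ℚ) → ℚ → List ℚ
  | [], _ => []
  | cj :: B, c => add cj (smul c (collapse B c))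

/-- `ev (collapse B c) t = evalB B c t`. -/
theorem ev_collapse : ∀ (B : List (List ℚ)) (c : ℚ) (t : ℝ), ev (collapse B c) t = evalB B c t
  | [], c, t => by simp [collapse]
  | cj :: B, c, t => by rw [collapse, ev_add, ev_smul, ev_collapse B c t, evalB_cons]

/-- **Taylor shift at a rational point**: `ev l (c + y) = ev (collapse (shiftB l) c) y`. -/
theorem ev_collapse_shiftB (l : List ℚ) (c : ℚ) (y : ℝ) : ev l ((c : ℝ) + y) = ev (collapse (shiftB l) c) y := by
  rw [ev_collapse, evalB_shiftB]

/-- The rational upper bound of `ev l` on `[L₀, L₀ + δ]`: constant Taylor coefficient plus `δ ·` absolute bound of the rest. -/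
def evalUpperQ (l : List ℚ) (L0 δ : ℚ) : ℚ :=
  (collapse (shiftB l) L0).headD 0 + δ * absBound (collapse (shiftB l) L0).tail δ

/-- For `a :: as`: `ev (a :: as) y ≤ a + δ · absBound as δ` when `0 ≤ y ≤ δ`. -/
theorem ev_le_head_add {l : List ℚ} {y : ℝ} {δ : ℚ} (hy0 : 0 ≤ y) (hy : y ≤ δ) :
    ev l y ≤ (l.headD 0 : ℝ) + δ * absBound l.tail δ := by
  cases l with
  | nil => simp; exact mul_nonneg (hy0.trans hy) (by exact_mod_cast absBound_nonneg [] (by exact_mod_cast hy0.trans hy))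
  | cons a as =>
      simp only [List.headD_cons, List.tail_cons, ev_cons]
      have h1 : |ev as y| ≤ (absBound as δ : ℝ) := abs_ev_le_absBound as (by rw [abs_of_nonneg hy0]; exact hy)
      have h2 : y * ev as y ≤ δ * absBound as δ := by
        calc y * ev as y ≤ y * |ev as y| := mul_le_mul_of_nonneg_left (le_abs_self _) hy0
          _ ≤ δ * absBound as δ := mul_le_mul hy h1 (abs_nonneg _) (hy0.trans hy)
      linarith

/-- **Value bound at an enclosed point**: if `L₀ ≤ L ≤ L₀ + δ` then `ev l L ≤ evalUpperQ l L₀ δ`. -/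
theorem ev_le_evalUpperQ (l : List ℚ) {L0 δ : ℚ} {L : ℝ} (h0 : (L0 : ℝ) ≤ L) (h1 : L ≤ (L0 : ℝ) + δ) :
    ev l L ≤ (evalUpperQ l L0 δ : ℝ) := by
  have e : L = (L0 : ℝ) + (L - L0) := by ring
  rw [e, ev_collapse_shiftB, evalUpperQ]
  push_cast
  exact ev_le_head_add (by linarith) (by linarith)

/-! ## The polar moment `Ĝ(1)` -/

section Polar

variable {p : List ℚ} {b : ℚ}

/-- `Ĝ(1) = ∫_{−b}^{b} p(x) e^{x/2} dx` (a real number) for the polynomial window. -/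
theorem weilMellin_polyWitness_one (hb : 0 < b) :
    weilMellin (polyWitness p b) 1 = ((∫ x in (-(b : ℝ))..b, ev p x * Real.exp (x / 2) : ℝ) : ℂ) := by
  have hb' : (0 : ℝ) < b := by exact_mod_cast hb
  unfold weilMellin
  have e1 : (fun t : ℝ ↦ polyWitness p b t * Complex.exp ((1 - 1 / 2) * (t : ℂ)))
      = fun t ↦ (((polyWitnessRe p b t * Real.exp (t / 2) : ℝ)) : ℂ) := by
    funext t
    rw [polyWitness, show ((1 : ℂ) - 1 / 2) * (t : ℂ) = ((t / 2 : ℝ) : ℂ) by push_cast; ring,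
      ← Complex.ofReal_exp]
    push_cast; ring
  rw [e1, integral_complex_ofReal]
  congr 1
  rw [← setIntegral_eq_integral_of_forall_compl_eq_zero (s := Icc (-(b : ℝ)) b)
    (fun x hx ↦ by rw [polyWitnessRe_of_not_mem hx, zero_mul])]
  rw [setIntegral_congr_fun measurableSet_Icc
    (fun x hx ↦ by simp only [polyWitnessRe_of_mem hx] :
      EqOn (fun x ↦ polyWitnessRe p b x * Real.exp (x / 2)) (fun x ↦ ev p x * Real.exp (x / 2)) (Icc (-(b : ℝ)) b))]
  rw [integral_Icc_eq_integral_Ioc, ← intervalIntegral.integral_of_le (by linarith)]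

/-- `I_n = ∫_{−b}^{b} p(x) T_n(x/2) dx` as a rational (`T_n(x/2) = ev (expPartL n) x`). -/
def mellinOnePartialQ (p : List ℚ) (b : ℚ) (n : ℕ) : ℚ :=
  evQ (integ (mul p (expPartL n))) b - evQ (integ (mul p (expPartL n))) (-b)

/-- `ε_n = 2b · absBound p b · (b/2)^n (n+1)/(n!·n)`. -/
def mellinOneErrQ (p : List ℚ) (b : ℚ) (n : ℕ) : ℚ :=
  2 * b * absBound p b * ((b / 2) ^ n * (n + 1) / (n.factorial * n))

/-- The Maclaurin remainder of `exp` on `[−b/2, b/2]`, `b ≤ 2`: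
`|e^{x/2} − T_n(x/2)| ≤ (b/2)^n (n+1)/(n!·n)` for `|x| ≤ b`. -/
theorem abs_exp_half_sub_expPartL_le {n : ℕ} (hn : 0 < n) (hb2 : (b : ℝ) ≤ 2) {x : ℝ} (hx : |x| ≤ b) :
    |Real.exp (x / 2) - ev (expPartL n) x| ≤ ((b : ℝ) / 2) ^ n * (n + 1) / (n.factorial * n) := by
  have hx2 : |x / 2| ≤ 1 := by rw [abs_div, abs_two]; linarith
  have h := Real.exp_bound hx2 hn
  rw [ev_expPartL]
  have hxb : |x / 2| ≤ (b : ℝ) / 2 := by rw [abs_div, abs_two]; linarith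
  have h3 : |x / 2| ^ n ≤ ((b : ℝ) / 2) ^ n := pow_le_pow_left₀ (abs_nonneg _) hxb n
  calc |Real.exp (x / 2) - ∑ j ∈ range n, (x / 2) ^ j / (j.factorial : ℝ)|
      ≤ |x / 2| ^ n * ((n.succ : ℝ) / (n.factorial * n)) := h
    _ ≤ ((b : ℝ) / 2) ^ n * ((n.succ : ℝ) / (n.factorial * n)) :=
        mul_le_mul_of_nonneg_right h3 (by positivity)
    _ = ((b : ℝ) / 2) ^ n * (n + 1) / (n.factorial * n) := by push_cast; ring

/-- **Enclosure of the polar moment**: `|∫_{−b}^{b} p(x) e^{x/2} dx − I_n| ≤ ε_n` (`0 < b ≤ 2`, `n ≥ 1`). -/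
theorem abs_mellinOne_sub_partial_le {n : ℕ} (hn : 0 < n) (hb : 0 < b) (hb2 : (b : ℝ) ≤ 2) :
    |(∫ x in (-(b : ℝ))..b, ev p x * Real.exp (x / 2)) - (mellinOnePartialQ p b n : ℝ)|
      ≤ (mellinOneErrQ p b n : ℝ) := by
  have hb' : (0 : ℝ) < b := by exact_mod_cast hb
  have eI : (mellinOnePartialQ p b n : ℝ) = ∫ x in (-(b : ℝ))..b, ev p x * ev (expPartL n) x := by
    rw [mellinOnePartialQ]
    push_cast
    rw [← ev_ratCast, ← ev_ratCast]
    push_cast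
    rw [← integral_ev]
    exact intervalIntegral.integral_congr fun x _ ↦ by simp only [ev_mul]
  have hf : IntervalIntegrable (fun x ↦ ev p x * Real.exp (x / 2)) volume (-(b : ℝ)) b :=
    ((continuous_ev p).mul (Real.continuous_exp.comp (continuous_id.div_const 2))).intervalIntegrable _ _
  have hg : IntervalIntegrable (fun x ↦ ev p x * ev (expPartL n) x) volume (-(b : ℝ)) b :=
    ((continuous_ev p).mul (continuous_ev _)).intervalIntegrable _ _
  rw [eI, ← intervalIntegral.integral_sub hf hg]
  have hbound : ∀ x ∈ Ι (-(b : ℝ)) b, ‖ev p x * Real.exp (x / 2) - ev p x * ev (expPartL n) x‖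
      ≤ (absBound p b : ℝ) * (((b : ℝ) / 2) ^ n * (n + 1) / (n.factorial * n)) := by
    intro x hx
    have hx' : |x| ≤ b := by
      rw [Set.uIoc_of_le (by linarith)] at hx
      exact abs_le.2 ⟨by linarith [hx.1], hx.2⟩
    rw [← mul_sub, norm_mul, Real.norm_eq_abs, Real.norm_eq_abs]
    exact mul_le_mul (abs_ev_le_absBound p hx') (abs_exp_half_sub_expPartL_le hn hb2 hx') (abs_nonneg _)
      (by exact_mod_cast absBound_nonneg p hb.le)
  have h := intervalIntegral.norm_integral_le_of_norm_le_const hbound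
  rw [Real.norm_eq_abs] at h
  refine h.trans (le_of_eq ?_)
  rw [mellinOneErrQ, abs_of_pos (by linarith : (0:ℝ) < b - -(b:ℝ))]
  push_cast
  ring

/-- The rational lower bound of `‖Ĝ(1)‖`: `max (|I_n| − ε_n) 0`. -/
def mellinOneLowerQ (p : List ℚ) (b : ℚ) (n : ℕ) : ℚ := max (|mellinOnePartialQ p b n| - mellinOneErrQ p b n) 0

/-- **Lower bound of the polar moment**: `mellinOneLowerQ p b n ≤ ‖Ĝ(1)‖` (`0 < b ≤ 2`, `n ≥ 1`). -/
theorem mellinOneLowerQ_le_norm {n : ℕ} (hn : 0 < n) (hb : 0 < b) (hb2 : (b : ℝ) ≤ 2) :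
    (mellinOneLowerQ p b n : ℝ) ≤ ‖weilMellin (polyWitness p b) 1‖ := by
  rw [weilMellin_polyWitness_one hb, Complex.norm_real, Real.norm_eq_abs, mellinOneLowerQ]
  push_cast
  refine max_le ?_ (abs_nonneg _)
  have h := abs_mellinOne_sub_partial_le (p := p) hn hb hb2
  have := abs_sub_abs_le_abs_sub (mellinOnePartialQ p b n : ℝ) (∫ x in (-(b : ℝ))..b, ev p x * Real.exp (x / 2))
  rw [abs_sub_comm] at this
  linarith

end Polar

/-! ## Kernel regression -/

/-- For `p = x` on `[−1,1]`: `I_2 = ∫_{−1}^{1} x(1 + x/2) dx = 1/3`. -/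
example : mellinOnePartialQ [0, 1] 1 2 = 1 / 3 := by decide +kernel

/-- Taylor shift of `1 + t²` at `c = 1`: coefficients `[2, 2, 1]`; upper bound on `[1, 1 + 1/10]` is `2 + (1/10)(2 + 1/10) `. -/
example : collapse (shiftB [1, 0, 1]) 1 = [2, 2, 1] ∧ evalUpperQ [1, 0, 1] 1 (1 / 10) = 221 / 100 := by
  decide +kernel

end Summit.RiemannHypothesis.RiemannHypothesis.Theorems.SemilocalPolyWitness

end
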